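import Literature.MathematicalPhysics.KineticTheory.ShortFlightCount
import Literature.MathematicalPhysics.KineticTheory.HardSphereCanonicalClusterBound
import Summits.AtomisticToContinuum.HydrodynamicLimit.Theorems.JParityClosureCollisionTightnessSweptTube
import Summits.AtomisticToContinuum.HydrodynamicLimit.Theorems.JParityClosureCollisionTightnessTorusGibbs
import Summits.AtomisticToContinuum.HydrodynamicLimit.Theorems.JParityClosureOddContactSymmetryGibbsInvariance
import Summits.AtomisticToContinuum.HydrodynamicLimit.Theorems.JParityClosureKineticEnergyTailsApriori
import HarnessLib

/-!
# Crux `JParityClosure.EvenStressEnskog` (stmt-AtomisticToContinuum-13079), line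
# `even-rung-mean-variance`: helper stub `stub_shortFlightDeficitRung0` ((S2b₂) at rung 0)

At RUNG 0 (constant profiles: the local Gibbs law is the homogeneous canonical Gibbs law `G_N`,
stationary under every hard-sphere flow, `measurePreserving_flow_localGibbsLaw_const`) the
SHORT-FLIGHT-DEFICIT residual `R_short = shortFlightDeficit` of the collision-cylinder pull-back
(`CollisionTubePullbackDefs`) is small in `G_N`-probability for `κ < κ₀(L, η, δ, τ, u, θ)`, uniformly in
`N ≥ 1`: `G_N{η < ((N+1)κ)⁻¹ R_short} ≤ δ`.

Proof.  Pathwise `R_short ≤ 2L · κε · #short` (`shortFlightDeficit_le_mul_count`: `|Ξ_L| ≤ 2L`,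
`abs_evenMarkTrunc_le`; the deficit of one collision is at most `κ ε` and vanishes unless a partner
collided during `(s − κε, s)` or `s < κ ε`), where `#short` is the short-flight count of window `ℓ = κ ε`.
The window bound `localGibbsLaw_shortFlightCount_ge_le` of `Literature/…/ShortFlightCount` (pathwise
charging to early collisions, fast re-collisions and forward contact partners; collision-flux and
three-label Palm bounds), with its static inputs discharged here (`posGibbs_pairEvent_le`,
`posGibbs_tripleEvent_le`, `exists_sweptTube`, `volume_setOf_exists_reprSym_add_latticeVec_mem_le`,
`measurePreserving_flow_localGibbsLaw_const`) and the Gaussian moments `E‖w − v‖ ≤ 1 + E‖w − v‖²`,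
`E‖w − v‖² ≤ 4(‖u‖² + 3θ)`, gives `shortFlightCountRung0_le`:
`G_N{#short ≥ y} ≤ y⁻¹ (1 + 4(‖u‖² + 3θ)) ℓ (48 (N+1)²ε² + 192 τ (N+1)²ε² + 1536 τ (N+1)³ε⁴)`.
With `y = η(N+1)/(2Lε)`, `ℓ = κε`, `(N+1)ε³ = σ³ ≤ 1` this is `≤ 2L(1 + 4(‖u‖² + 3θ))(48 + 1728 τ) κ/η`.

References: C. Cercignani, R. Illner, M. Pulvirenti, *The Mathematical Theory of Dilute Gases* (1994),
§2.2, App. 4.A; I. Gallagher, L. Saint-Raymond, B. Texier, *From Newton to Boltzmann* (2013), Prop. 4.1.1;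
D. Ruelle, *Statistical Mechanics: Rigorous Results* (1969), §4.2.
-/

noncomputable section

open MeasureTheory Set Filter Topology
open scoped ENNReal InnerProductSpace BigOperators Classical

namespace Summit.AtomisticToContinuum.HydrodynamicLimit.Theorems.EvenStressEnskog

open Literature.Analysis.FluidPDE Literature.MathematicalPhysics.KineticTheory

/-! ### Gaussian moments of the relative velocity -/

/-- `E‖w − v‖² ≤ 4(‖u‖² + 3θ)` for two independent `N(u, θ id)` velocities (`‖w − v‖² ≤ 2‖v‖² + 2‖w‖²`).
[folklore] -/
theorem lintegral_relSpeed_sq_le (u : V3) {θ : ℝ} (hθ : 0 < θ) :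
    ∫⁻ q, ENNReal.ofReal (‖q.2 - q.1‖ ^ 2) ∂((gaussMeasure u θ).prod (gaussMeasure u θ)) ≤
      ENNReal.ofReal (4 * (‖u‖ ^ 2 + 3 * θ)) := by
  set γ := gaussMeasure u θ with hγ
  have hm : Measurable fun v : V3 => ENNReal.ofReal (‖v‖ ^ 2) := by fun_prop
  have hle : ∀ q : V3 × V3, ENNReal.ofReal (‖q.2 - q.1‖ ^ 2) ≤
      2 * ENNReal.ofReal (‖q.1‖ ^ 2) + 2 * ENNReal.ofReal (‖q.2‖ ^ 2) := by
    intro q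
    have h1 : ‖q.2 - q.1‖ ≤ ‖q.2‖ + ‖q.1‖ := norm_sub_le _ _
    have h2 : ‖q.2 - q.1‖ ^ 2 ≤ 2 * ‖q.1‖ ^ 2 + 2 * ‖q.2‖ ^ 2 := by
      nlinarith [norm_nonneg (q.2 - q.1), norm_nonneg q.1, norm_nonneg q.2, sq_nonneg (‖q.1‖ - ‖q.2‖)]
    calc ENNReal.ofReal (‖q.2 - q.1‖ ^ 2) ≤ ENNReal.ofReal (2 * ‖q.1‖ ^ 2 + 2 * ‖q.2‖ ^ 2) :=
          ENNReal.ofReal_le_ofReal h2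
      _ = 2 * ENNReal.ofReal (‖q.1‖ ^ 2) + 2 * ENNReal.ofReal (‖q.2‖ ^ 2) := by
          rw [ENNReal.ofReal_add (by positivity) (by positivity), ENNReal.ofReal_mul (by norm_num),
            ENNReal.ofReal_mul (by norm_num), ENNReal.ofReal_ofNat]
  have hI1 : ∫⁻ q, ENNReal.ofReal (‖q.1‖ ^ 2) ∂(γ.prod γ) = ENNReal.ofReal (‖u‖ ^ 2 + 3 * θ) := by
    rw [lintegral_prod (fun q : V3 × V3 => ENNReal.ofReal (‖q.1‖ ^ 2)) (by fun_prop)]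
    simp only [lintegral_const, measure_univ, mul_one]
    exact lintegral_norm_sq_gaussMeasure u hθ
  have hI2 : ∫⁻ q, ENNReal.ofReal (‖q.2‖ ^ 2) ∂(γ.prod γ) = ENNReal.ofReal (‖u‖ ^ 2 + 3 * θ) := by
    rw [lintegral_prod (fun q : V3 × V3 => ENNReal.ofReal (‖q.2‖ ^ 2)) (by fun_prop)]
    dsimp only
    rw [lintegral_const, measure_univ, mul_one]
    exact lintegral_norm_sq_gaussMeasure u hθ
  calc ∫⁻ q, ENNReal.ofReal (‖q.2 - q.1‖ ^ 2) ∂(γ.prod γ)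
      ≤ ∫⁻ q, (2 * ENNReal.ofReal (‖q.1‖ ^ 2) + 2 * ENNReal.ofReal (‖q.2‖ ^ 2)) ∂(γ.prod γ) := lintegral_mono hle
    _ = 2 * ENNReal.ofReal (‖u‖ ^ 2 + 3 * θ) + 2 * ENNReal.ofReal (‖u‖ ^ 2 + 3 * θ) := by
        rw [lintegral_add_left (f := fun q : V3 × V3 => 2 * ENNReal.ofReal (‖q.1‖ ^ 2)) (by fun_prop),
          lintegral_const_mul 2 (f := fun q : V3 × V3 => ENNReal.ofReal (‖q.1‖ ^ 2)) (by fun_prop),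
          lintegral_const_mul 2 (f := fun q : V3 × V3 => ENNReal.ofReal (‖q.2‖ ^ 2)) (by fun_prop), hI1, hI2]
    _ = ENNReal.ofReal (4 * (‖u‖ ^ 2 + 3 * θ)) := by
        rw [← add_mul, (by norm_num : (2 : ℝ≥0∞) + 2 = ENNReal.ofReal 4), ← ENNReal.ofReal_mul (by norm_num)]

/-- `E‖w − v‖ ≤ 1 + 4(‖u‖² + 3θ)` for two independent `N(u, θ id)` velocities (`x ≤ 1 + x²`). [folklore] -/
theorem lintegral_relSpeed_le (u : V3) {θ : ℝ} (hθ : 0 < θ) :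
    ∫⁻ q, ENNReal.ofReal ‖q.2 - q.1‖ ∂((gaussMeasure u θ).prod (gaussMeasure u θ)) ≤
      ENNReal.ofReal (1 + 4 * (‖u‖ ^ 2 + 3 * θ)) := by
  have hm : Measurable fun q : V3 × V3 => ENNReal.ofReal (‖q.2 - q.1‖ ^ 2) := by fun_prop
  have hle : ∀ q : V3 × V3, ENNReal.ofReal ‖q.2 - q.1‖ ≤ 1 + ENNReal.ofReal (‖q.2 - q.1‖ ^ 2) := by
    intro q
    calc ENNReal.ofReal ‖q.2 - q.1‖ ≤ ENNReal.ofReal (1 + ‖q.2 - q.1‖ ^ 2) :=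
          ENNReal.ofReal_le_ofReal (by nlinarith [norm_nonneg (q.2 - q.1), sq_nonneg (‖q.2 - q.1‖ - 1)])
      _ = 1 + ENNReal.ofReal (‖q.2 - q.1‖ ^ 2) := by
          rw [ENNReal.ofReal_add zero_le_one (by positivity), ENNReal.ofReal_one]
  calc ∫⁻ q, ENNReal.ofReal ‖q.2 - q.1‖ ∂((gaussMeasure u θ).prod (gaussMeasure u θ))
      ≤ ∫⁻ q, (1 + ENNReal.ofReal (‖q.2 - q.1‖ ^ 2)) ∂((gaussMeasure u θ).prod (gaussMeasure u θ)) :=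
        lintegral_mono hle
    _ = 1 + ∫⁻ q, ENNReal.ofReal (‖q.2 - q.1‖ ^ 2) ∂((gaussMeasure u θ).prod (gaussMeasure u θ)) := by
        rw [lintegral_add_right _ hm, lintegral_const, measure_univ, mul_one]
    _ ≤ 1 + ENNReal.ofReal (4 * (‖u‖ ^ 2 + 3 * θ)) := add_le_add le_rfl (lintegral_relSpeed_sq_le u hθ)
    _ = ENNReal.ofReal (1 + 4 * (‖u‖ ^ 2 + 3 * θ)) := by
        rw [ENNReal.ofReal_add zero_le_one (by positivity), ENNReal.ofReal_one]

/-! ### The short-flight count at rung 0 (discharged window bound) -/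

/-- **Registered helper `shortFlightCountRung0_le` (short-flight count at rung 0).**  For constant profiles
`a, θ > 0`, `u` there is `σ₀ > 0` such that for `0 < σ < σ₀`, `N ≥ 1`, every hard-sphere flow `Φ` and
`τ, ℓ, y > 0`, the canonical-Gibbs probability that a good orbit has at least `y` ordered collisions
`(s, i, j)`, `s ∈ [0, τ]`, with pair flight start `> s − ℓ` (a partner collided in `(s − ℓ, s)`, or `s < ℓ`)
is at most `y⁻¹ (1 + 4(‖u‖² + 3θ)) ℓ (48 (N+1)²ε² + 192 τ (N+1)²ε² + 1536 τ (N+1)³ε⁴)`, `ε = hsDiameter σ N`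
(`localGibbsLaw_shortFlightCount_ge_le` with the rung-0 statics discharged). [folklore] -/
theorem shortFlightCountRung0_le : ∀ (a θ : ℝ) (u : V3), 0 < a → 0 < θ → ∃ σ₀ : ℝ, 0 < σ₀ ∧ ∀ σ : ℝ, 0 < σ → σ < σ₀ → ∀ N : ℕ, 1 ≤ N → ∀ Φ : HardSphereFlow (Torus.geometry (Fin 3)) (hsDiameter σ N) (N + 1), ∀ τ ℓ y : ℝ, 0 < τ → 0 < ℓ → 0 < y → localGibbsLaw σ (fun _ => a) (fun _ => u) (fun _ => θ) N Φ {z | z ∈ Φ.good ∧ y ≤ collisionPairSum (Torus.geometry (Fin 3)) (hsDiameter σ N) (orbit σ N Φ z) (Set.Icc 0 τ) (fun s i j => if s - ℓ < pairFlightStart σ N Φ z i j s then (1 : ℝ) else 0)} ≤ ENNReal.ofReal ((1 + 4 * (‖u‖ ^ 2 + 3 * θ)) * ℓ * (48 * ((N + 1 : ℕ) : ℝ) ^ 2 * hsDiameter σ N ^ 2 + 192 * τ * ((N + 1 : ℕ) : ℝ) ^ 2 * hsDiameter σ N ^ 2 + 1536 * τ * ((N + 1 : ℕ) : ℝ) ^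 3 * hsDiameter σ N ^ 4) / y) := by
  intro a θ u ha hθ
  obtain ⟨σ₁, hσ₁, hsmall⟩ := exists_smallDensity uniformProfile one_pos
  refine ⟨min σ₁ (1 / 4), lt_min hσ₁ (by norm_num), fun σ hσ hσlt N hN Φ τ ℓ y hτ hℓ hy => ?_⟩
  have hsm : SmallDensity uniformProfile σ := (hsmall σ hσ (hσlt.trans_le (min_le_left _ _))).1
  have hσ4 : σ ≤ 1 / 4 := (hσlt.trans_le (min_le_right _ _)).le
  have h := localGibbsLaw_shortFlightCount_ge_le hσ.le hσ4 ha hθ u Φ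
    (measurePreserving_flow_localGibbsLaw_const σ a θ u N Φ)
    (fun i j hij T hT => posGibbs_pairEvent_le hsm hN hij hT)
    (fun i j k hij hik hjk T T' hT hT' => posGibbs_tripleEvent_le hsm hij hik hjk hT hT')
    (fun h hh => exists_sweptTube (hsDiameter_pos hσ N) hh)
    (fun S hS => by simpa only [sub_zero] using volume_setOf_exists_reprSym_add_latticeVec_mem_le 0 hS) hτ hℓ hy
  refine h.trans ?_
  set M₁ : ℝ := 1 + 4 * (‖u‖ ^ 2 + 3 * θ) with hM₁
  have hM₁0 : 0 ≤ M₁ := by positivity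
  have hm₁ := lintegral_relSpeed_le u hθ
  have hm₂ : ∫⁻ q, ENNReal.ofReal (‖q.2 - q.1‖ ^ 2) ∂((gaussMeasure u θ).prod (gaussMeasure u θ)) ≤
      ENNReal.ofReal M₁ :=
    (lintegral_relSpeed_sq_le u hθ).trans (ENNReal.ofReal_le_ofReal (by linarith))
  have hε : 0 ≤ hsDiameter σ N := (hsDiameter_pos hσ N).le
  calc ENNReal.ofReal (48 * ℓ * ((N + 1 : ℕ) : ℝ) ^ 2 * hsDiameter σ N ^ 2 / y) *
          ∫⁻ q, ENNReal.ofReal ‖q.2 - q.1‖ ∂((gaussMeasure u θ).prod (gaussMeasure u θ)) +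
        ENNReal.ofReal ((192 * τ * ℓ * ((N + 1 : ℕ) : ℝ) ^ 2 * hsDiameter σ N ^ 2 +
            1536 * τ * ℓ * ((N + 1 : ℕ) : ℝ) ^ 3 * hsDiameter σ N ^ 4) / y) *
          ∫⁻ q, ENNReal.ofReal (‖q.2 - q.1‖ ^ 2) ∂((gaussMeasure u θ).prod (gaussMeasure u θ))
      ≤ ENNReal.ofReal (48 * ℓ * ((N + 1 : ℕ) : ℝ) ^ 2 * hsDiameter σ N ^ 2 / y) * ENNReal.ofReal M₁ +
        ENNReal.ofReal ((192 * τ * ℓ * ((N + 1 : ℕ) : ℝ) ^ 2 * hsDiameter σ N ^ 2 +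
            1536 * τ * ℓ * ((N + 1 : ℕ) : ℝ) ^ 3 * hsDiameter σ N ^ 4) / y) * ENNReal.ofReal M₁ := by
        gcongr
    _ = ENNReal.ofReal ((48 * ℓ * ((N + 1 : ℕ) : ℝ) ^ 2 * hsDiameter σ N ^ 2 / y +
          (192 * τ * ℓ * ((N + 1 : ℕ) : ℝ) ^ 2 * hsDiameter σ N ^ 2 +
            1536 * τ * ℓ * ((N + 1 : ℕ) : ℝ) ^ 3 * hsDiameter σ N ^ 4) / y) * M₁) := by
        rw [← ENNReal.ofReal_mul (by positivity), ← ENNReal.ofReal_mul (by positivity),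
          ← ENNReal.ofReal_add (by positivity) (by positivity), add_mul]
    _ = ENNReal.ofReal ((1 + 4 * (‖u‖ ^ 2 + 3 * θ)) * ℓ * (48 * ((N + 1 : ℕ) : ℝ) ^ 2 * hsDiameter σ N ^ 2 +
          192 * τ * ((N + 1 : ℕ) : ℝ) ^ 2 * hsDiameter σ N ^ 2 +
          1536 * τ * ((N + 1 : ℕ) : ℝ) ^ 3 * hsDiameter σ N ^ 4) / y) := by
        congr 1
        rw [hM₁]
        field_simp
        ring

/-! ### The stub -/

/-- **Registered helper stub `stub_shortFlightDeficitRung0`** ((S2b₂) at rung 0) of the line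
`even-rung-mean-variance` of crux stmt-AtomisticToContinuum-13079: under the rung-0 (homogeneous) Gibbs law
the normalised short-flight deficit `((N+1)κ)⁻¹ · shortFlightDeficit` of the collision-cylinder pull-back
with the truncated even mark `Ξ_L` exceeds `η` with probability at most `δ`, for all `κ < κ₀` and
`N ≥ N₀ = 1`, `κ₀` NOT depending on `N` (`R_short ≤ 2Lκε · #short` pathwise and `shortFlightCountRung0_le`
with `y = η(N+1)/(2Lε)`, `ℓ = κ ε`, `(N+1)ε³ = σ³ ≤ 1`). [folklore] -/
theorem stub_shortFlightDeficitRung0 : ∃ η₀ : ℝ, 0 < η₀ ∧ ∀ (a θ : ℝ) (u : V3), 0 < a → 0 < θ → ∃ σ₀ : ℝ, 0 < σ₀ ∧ ∀ σ : ℝ, 0 < σ → σ < σ₀ → ∀ Φ : (N : ℕ) → HardSphereFlow (Torus.geometry (Fin 3)) (hsDiameter σ N) (N + 1), ∀ τ : ℝ, 0 < τ → ∀ χ : ℝ × UnitAddTorus (Fin 3) → ℝ, Continuous χ → ∀ g : ℝ → ℝ, Continuous g → (∀ a, η₀ ≤ a → g a = 0) → ∀ η δ : ℝ, 0 < η → 0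 < δ → ∃ r₀ : ℝ, 0 < r₀ ∧ ∀ r : ℝ, 0 < r → r < r₀ → ∀ L : ℝ, 1 ≤ L → ∃ κ₀ : ℝ, 0 < κ₀ ∧ ∀ κ : ℝ, 0 < κ → κ < κ₀ → ∃ N₀ : ℕ, ∀ N : ℕ, N₀ ≤ N → ∀ k l : Fin 3, localGibbsLaw σ (fun _ => a) (fun _ => u) (fun _ => θ) N (Φ N) {z | η < ((N + 1 : ℝ) * κ)⁻¹ * shortFlightDeficit σ N (Φ N) τ (evenMarkTrunc k l L) κ z} ≤ ENNReal.ofReal δ := by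
  refine ⟨1, one_pos, fun a θ u ha hθ => ?_⟩
  obtain ⟨σ₀, hσ₀, hcount⟩ := shortFlightCountRung0_le a θ u ha hθ
  refine ⟨min σ₀ 1, lt_min hσ₀ one_pos, fun σ hσ hσlt Φ τ hτ χ _ g _ _ η δ hη hδ => ⟨1, one_pos, fun r _ _ L hL => ?_⟩⟩
  have hσ₀' : σ < σ₀ := hσlt.trans_le (min_le_left _ _)
  have hσ1 : σ ≤ 1 := (hσlt.trans_le (min_le_right _ _)).le
  have hL0 : 0 < L := by linarith
  set M₁ : ℝ := 1 + 4 * (‖u‖ ^ 2 + 3 * θ) with hM₁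
  have hM₁0 : 0 < M₁ := by positivity
  set A : ℝ := 2 * L * M₁ * (48 + 1728 * τ) / η with hA
  have hA0 : 0 < A := by positivity
  refine ⟨δ / (A + 1), by positivity, fun κ hκ hκlt => ⟨1, fun N hN k l => ?_⟩⟩
  have hε : 0 < hsDiameter σ N := hsDiameter_pos hσ N
  have hε1 : hsDiameter σ N ≤ 1 := (hsDiameter_le hσ.le N).trans hσ1
  have hℓ : 0 < κ * hsDiameter σ N := mul_pos hκ hε
  have hn : (0 : ℝ) < (N + 1 : ℝ) := by positivity
  set P := localGibbsLaw σ (fun _ => a) (fun _ => u) (fun _ => θ) N (Φ N) with hP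
  have hΨ : ∀ q, |evenMarkTrunc k l L q| ≤ 2 * L := abs_evenMarkTrunc_le k l hL0.le
  set y : ℝ := η * (N + 1 : ℝ) / (2 * L * hsDiameter σ N) with hy
  have hy0 : 0 < y := by positivity
  -- pathwise: a large normalised deficit forces a large short-flight count
  set B : Set (Config (N + 1) (Fin 3) T3) := {z | z ∈ (Φ N).good ∧ y ≤
      collisionPairSum (Torus.geometry (Fin 3)) (hsDiameter σ N) (orbit σ N (Φ N) z) (Set.Icc 0 τ)
        (fun s i j => if s - κ * hsDiameter σ N < pairFlightStart σ N (Φ N) z i j s then (1 : ℝ) else 0)} with hB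
  have hsub : {z | η < ((N + 1 : ℝ) * κ)⁻¹ * shortFlightDeficit σ N (Φ N) τ (evenMarkTrunc k l L) κ z} ⊆
      (Φ N).goodᶜ ∪ B := by
    intro z hz
    by_cases hgood : z ∈ (Φ N).good
    · refine Or.inr ⟨hgood, ?_⟩
      have h1 := shortFlightDeficit_le_mul_count hgood hΨ τ hℓ
      have h2 : η < ((N + 1 : ℝ) * κ)⁻¹ * shortFlightDeficit σ N (Φ N) τ (evenMarkTrunc k l L) κ z := hz
      by_contra hlt
      have hlt' := not_le.1 hlt
      have h3 : shortFlightDeficit σ N (Φ N) τ (evenMarkTrunc k l L) κ z <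
          2 * L * (κ * hsDiameter σ N) * y :=
        h1.trans_lt (mul_lt_mul_of_pos_left hlt' (by positivity))
      have h4 : 2 * L * (κ * hsDiameter σ N) * y = η * ((N + 1 : ℝ) * κ) := by
        rw [hy]; field_simp
      rw [h4] at h3
      have h5 : ((N + 1 : ℝ) * κ)⁻¹ * shortFlightDeficit σ N (Φ N) τ (evenMarkTrunc k l L) κ z < η := by
        rw [inv_mul_lt_iff₀ (by positivity)]; linarith
      linarith
    · exact Or.inl hgood
  have hgood0 : P (Φ N).goodᶜ = 0 := by
    rw [hP, localGibbsLaw_eq]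
    exact localGibbsMeasure_absolutelyContinuous σ _ _ _ N (Φ N) (Φ N).measure_compl_good
  have hcnt : P B ≤ _ := hcount σ hσ hσ₀' N hN (Φ N) τ (κ * hsDiameter σ N) y hτ hℓ hy0
  -- arithmetic of the constants
  have hε3 : (N + 1 : ℝ) * hsDiameter σ N ^ 3 = σ ^ 3 := by exact_mod_cast succ_mul_hsDiameter_pow_three σ N
  have hσ3 : σ ^ 3 ≤ 1 := pow_le_one₀ hσ.le hσ1
  have hne4 : (N + 1 : ℝ) * hsDiameter σ N ^ 4 ≤ 1 := by
    calc (N + 1 : ℝ) * hsDiameter σ N ^ 4 = ((N + 1 : ℝ) * hsDiameter σ N ^ 3) * hsDiameter σ N := by ring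
      _ ≤ 1 * 1 := mul_le_mul (hε3 ▸ hσ3) hε1 hε.le zero_le_one
      _ = 1 := one_mul 1
  have hne6 : (N + 1 : ℝ) ^ 2 * hsDiameter σ N ^ 6 ≤ 1 := by
    calc (N + 1 : ℝ) ^ 2 * hsDiameter σ N ^ 6 = (((N + 1 : ℝ) * hsDiameter σ N ^ 3)) ^ 2 := by ring
      _ ≤ 1 := by rw [hε3]; exact pow_le_one₀ (by positivity) hσ3
  have hkey : M₁ * (κ * hsDiameter σ N) * (48 * (N + 1 : ℝ) ^ 2 * hsDiameter σ N ^ 2 +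
      192 * τ * (N + 1 : ℝ) ^ 2 * hsDiameter σ N ^ 2 + 1536 * τ * (N + 1 : ℝ) ^ 3 * hsDiameter σ N ^ 4) / y ≤ δ := by
    rw [div_le_iff₀ hy0, hy]
    have hS : hsDiameter σ N ^ 2 * (48 * (N + 1 : ℝ) ^ 2 * hsDiameter σ N ^ 2 +
        192 * τ * (N + 1 : ℝ) ^ 2 * hsDiameter σ N ^ 2 + 1536 * τ * (N + 1 : ℝ) ^ 3 * hsDiameter σ N ^ 4) ≤
        (N + 1 : ℝ) * (48 + 1728 * τ) := by
      calc hsDiameter σ N ^ 2 * (48 * (N + 1 : ℝ) ^ 2 * hsDiameter σ N ^ 2 +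
            192 * τ * (N + 1 : ℝ) ^ 2 * hsDiameter σ N ^ 2 + 1536 * τ * (N + 1 : ℝ) ^ 3 * hsDiameter σ N ^ 4)
          = (N + 1 : ℝ) * (48 * ((N + 1 : ℝ) * hsDiameter σ N ^ 4) + 192 * τ * ((N + 1 : ℝ) * hsDiameter σ N ^ 4) +
              1536 * τ * ((N + 1 : ℝ) ^ 2 * hsDiameter σ N ^ 6)) := by ring
        _ ≤ (N + 1 : ℝ) * (48 * 1 + 192 * τ * 1 + 1536 * τ * 1) := by gcongr
        _ = (N + 1 : ℝ) * (48 + 1728 * τ) := by ring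
    have hκA : A * κ ≤ δ := by
      have h1 : A * κ ≤ A * (δ / (A + 1)) := mul_le_mul_of_nonneg_left hκlt.le hA0.le
      have h2 : A * (δ / (A + 1)) ≤ δ := by
        rw [mul_div_assoc', div_le_iff₀ (by positivity)]; nlinarith
      exact h1.trans h2
    -- `2Lε · M₁ κ ε S ≤ δ η (N+1)`
    have hgoal : M₁ * (κ * hsDiameter σ N) * (48 * (N + 1 : ℝ) ^ 2 * hsDiameter σ N ^ 2 +
        192 * τ * (N + 1 : ℝ) ^ 2 * hsDiameter σ N ^ 2 + 1536 * τ * (N + 1 : ℝ) ^ 3 * hsDiameter σ N ^ 4) *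
        (2 * L * hsDiameter σ N) ≤ δ * (η * (N + 1 : ℝ)) := by
      calc M₁ * (κ * hsDiameter σ N) * (48 * (N + 1 : ℝ) ^ 2 * hsDiameter σ N ^ 2 +
            192 * τ * (N + 1 : ℝ) ^ 2 * hsDiameter σ N ^ 2 + 1536 * τ * (N + 1 : ℝ) ^ 3 * hsDiameter σ N ^ 4) *
            (2 * L * hsDiameter σ N)
          = 2 * L * M₁ * κ * (hsDiameter σ N ^ 2 * (48 * (N + 1 : ℝ) ^ 2 * hsDiameter σ N ^ 2 +
              192 * τ * (N + 1 : ℝ) ^ 2 * hsDiameter σ N ^ 2 + 1536 * τ * (N + 1 : ℝ) ^ 3 * hsDiameter σ N ^ 4)) := by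
            ring
        _ ≤ 2 * L * M₁ * κ * ((N + 1 : ℝ) * (48 + 1728 * τ)) :=
            mul_le_mul_of_nonneg_left hS (by positivity)
        _ = (A * κ) * (η * (N + 1 : ℝ)) := by rw [hA]; field_simp
        _ ≤ δ * (η * (N + 1 : ℝ)) := mul_le_mul_of_nonneg_right hκA (by positivity)
    rw [mul_div_assoc', le_div_iff₀ (by positivity)]
    exact hgoal
  have hcast : ((N + 1 : ℕ) : ℝ) = (N + 1 : ℝ) := by push_cast; ring
  calc P {z | η < ((N + 1 : ℝ) * κ)⁻¹ * shortFlightDeficit σ N (Φ N) τ (evenMarkTrunc k l L) κ z}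
      ≤ P ((Φ N).goodᶜ ∪ B) := measure_mono hsub
    _ ≤ P (Φ N).goodᶜ + P B := measure_union_le _ _
    _ ≤ 0 + ENNReal.ofReal (M₁ * (κ * hsDiameter σ N) * (48 * ((N + 1 : ℕ) : ℝ) ^ 2 * hsDiameter σ N ^ 2 +
          192 * τ * ((N + 1 : ℕ) : ℝ) ^ 2 * hsDiameter σ N ^ 2 +
          1536 * τ * ((N + 1 : ℕ) : ℝ) ^ 3 * hsDiameter σ N ^ 4) / y) := by
        rw [hgood0]
        exact add_le_add le_rfl hcnt
    _ ≤ ENNReal.ofReal δ := by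
        rw [zero_add, hcast]
        exact ENNReal.ofReal_le_ofReal hkey

end Summit.AtomisticToContinuum.HydrodynamicLimit.Theorems.EvenStressEnskog

end
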